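import Mathlib
import Literature.Computability.AlgebraicComplexity.QuantumFunctionals
import HarnessLib

/-!
# Hilbert–Mumford for `SL_m(ℂ)³` on `3`-tensors, I: the generic translate and a valuation ring

First file of the PROOF of the named fact
`Literature.RepresentationTheory.AlgebraicGroups.Kempf1978_thm14_tensor` (the Hilbert–Mumford
criterion in Kempf's closed-orbit form, for `SL³` acting factorwise on `ι → ι → ι → ℂ`), by the
valuative method (Mumford, GIT Ch. 2 §1; Kempf 1978 §1): theorems only.

Let `B = ℂ[x_{p,i,j}]/J`, `J = (det X⁽ᵖ⁾ - 1 : p ∈ Fin 3)`, be the coordinate ring of `SL_ι³` (an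
integral domain, `SpecialLinearCoordinateRingDomain.lean`) and `φ : B → L` an injective
`ℂ`-algebra map into a field (e.g. its fraction field). The *generic translate* of `v` is the tensor
`t_L = Ξ·v ∈ L^{ι×ι×ι}`, `Ξ⁽ᵖ⁾ = (φ x̄_{p,i,j})`, an `SL_ι(L)³`-translate of `v`. The ideal `J` is a
parameter with its defining equation `hJ`, to keep statements readable.

* `aeval_eq_zero_of_mem_closure_orbit` — a polynomial in the tensor entries that kills the generic
  translate vanishes on the `SL³(ℂ)`-orbit of `v`, hence at every point of its closure.
* `exists_valuationSubring_generic_translate` — **if `w ∈ cl(SL³(ℂ)·v)` then there is a valuation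
  subring `O ⊆ L` containing `ℂ` and all entries of `t_L`, modulo whose maximal ideal `t_L ≡ w`.**
  (Localise `ℂ[y]/ker` at the point `w`, embed into `L`, and dominate the local ring by a valuation
  ring: Mathlib's `IsLocalRing.exists_factor_valuationRing`, Stacks 00IA.)

Also recorded: naturality of the factorwise action under ring maps (`map_actTensor`).
-/

noncomputable section

open MvPolynomial Matrix
open scoped BigOperators

namespace Literature.RepresentationTheory.AlgebraicGroups

open Literature.Computability.AlgebraicComplexity

/-! ### Naturality of the action -/

/-- Ring maps commute with the factorwise action:
`ψ ((A,B,C)·t) = (ψA, ψB, ψC)·(ψ t)`. [folklore] -/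
theorem map_actTensor {R S F : Type*} [CommSemiring R] [CommSemiring S] [FunLike F R S]
    [RingHomClass F R S] (ψ : F)
    {ι κ μ ι' κ' μ' : Type*} [Fintype ι] [Fintype κ] [Fintype μ] (A : Matrix ι' ι R)
    (B : Matrix κ' κ R) (C : Matrix μ' μ R) (t : ι → κ → μ → R) (a : ι') (b : κ') (c : μ') :
    ψ (actTensor A B C t a b c) =
      actTensor (A.map ψ) (B.map ψ) (C.map ψ) (fun a b c => ψ (t a b c)) a b c := by
  simp only [actTensor_apply, map_sum, map_mul, Matrix.map_apply]

/-! ### The generic translate -/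

section Generic

variable {ι : Type} [Fintype ι] [DecidableEq ι]

/-- Evaluating the coordinate ring of `SL_ι³` at a point `g ∈ SL_ι(ℂ)³`: the `ℂ`-algebra map
`x_{p,i,j} ↦ (g p) i j` kills `J`. [folklore] -/
theorem aeval_mem_span_det_sub_one_eq_zero (g : Fin 3 → Matrix ι ι ℂ) (hg : ∀ p, (g p).det = 1)
    (J : Ideal (MvPolynomial (Fin 3 × ι × ι) ℂ))
    (hJ : J = Ideal.span (Set.range fun p : Fin 3 =>
      (Matrix.of fun i j => (X (p, i, j) : MvPolynomial (Fin 3 × ι × ι) ℂ)).det - 1)) :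
    ∀ a ∈ J, aeval (fun s : Fin 3 × ι × ι => g s.1 s.2.1 s.2.2) a = 0 := by
  intro a ha
  rw [hJ] at ha
  refine Submodule.span_induction (p := fun a _ => aeval
    (fun s : Fin 3 × ι × ι => g s.1 s.2.1 s.2.2) a = 0) ?_ (map_zero _)
    (fun x y _ _ hx hy => by rw [map_add, hx, hy, add_zero])
    (fun r x _ hx => by rw [smul_eq_mul, map_mul, hx, mul_zero]) ha
  rintro _ ⟨p, rfl⟩
  rw [map_sub, map_one, AlgHom.map_det]
  have : (aeval fun s : Fin 3 × ι × ι => g s.1 s.2.1 s.2.2).mapMatrix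
      (Matrix.of fun i j => (X (p, i, j) : MvPolynomial (Fin 3 × ι × ι) ℂ)) = g p := by
    ext i j
    rw [AlgHom.mapMatrix_apply, Matrix.map_apply, Matrix.of_apply, aeval_X]
  rw [this, hg p, sub_self]

/-- **Polynomials killing the generic translate vanish on the orbit closure.** Let `f ∈ ℂ[y_c]`
(`c ∈ ι³`) satisfy `f((Ξ·v)) = 0` in `L`, where `Ξ⁽ᵖ⁾ = (φ x̄_{p,i,j})` is the generic point of
`SL_ι³` pushed into the field `L` by an injective `ℂ`-algebra map `φ` from the coordinate ring.
Then `f` vanishes at every `w ∈ cl(SL_ι(ℂ)³·v)`: evaluating at `g ∈ SL³(ℂ)` factors through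
`B → ℂ`, `x ↦ g`, so `f(g·v) = 0`, and `{t | f(t) = 0}` is closed. [folklore] -/
theorem aeval_eq_zero_of_mem_closure_orbit (v w : ι → ι → ι → ℂ)
    (hcl : w ∈ closure (Set.range fun g : Matrix.SpecialLinearGroup ι ℂ ×
        Matrix.SpecialLinearGroup ι ℂ × Matrix.SpecialLinearGroup ι ℂ =>
      (fun a b c => ∑ a', ∑ b', ∑ c', (g.1 : Matrix ι ι ℂ) a a' * (g.2.1 : Matrix ι ι ℂ) b b' *
        (g.2.2 : Matrix ι ι ℂ) c c' * v a' b' c')))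
    (J : Ideal (MvPolynomial (Fin 3 × ι × ι) ℂ))
    (hJ : J = Ideal.span (Set.range fun p : Fin 3 =>
      (Matrix.of fun i j => (X (p, i, j) : MvPolynomial (Fin 3 × ι × ι) ℂ)).det - 1))
    {L : Type*} [Field L] [Algebra ℂ L] (φ : (MvPolynomial (Fin 3 × ι × ι) ℂ ⧸ J) →ₐ[ℂ] L)
    (hφ : Function.Injective φ) (f : MvPolynomial (ι × ι × ι) ℂ)
    (hf : aeval (fun c : ι × ι × ι => actTensor
        (Matrix.of fun i j => φ (Ideal.Quotient.mk J (X ((0 : Fin 3), i, j))))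
        (Matrix.of fun i j => φ (Ideal.Quotient.mk J (X ((1 : Fin 3), i, j))))
        (Matrix.of fun i j => φ (Ideal.Quotient.mk J (X ((2 : Fin 3), i, j))))
        (fun a b c => algebraMap ℂ L (v a b c)) c.1 c.2.1 c.2.2) f = 0) :
    aeval (fun c : ι × ι × ι => w c.1 c.2.1 c.2.2) f = 0 := by
  classical
  -- the generic translate over `B = ℂ[x]/J`
  set ΞB : Fin 3 → Matrix ι ι (MvPolynomial (Fin 3 × ι × ι) ℂ ⧸ J) := fun p =>
    Matrix.of fun i j => Ideal.Quotient.mk J (X (p, i, j)) with hΞB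
  set vB : ι → ι → ι → MvPolynomial (Fin 3 × ι × ι) ℂ ⧸ J := fun a b c =>
    algebraMap ℂ (MvPolynomial (Fin 3 × ι × ι) ℂ ⧸ J) (v a b c) with hvB
  set θB : MvPolynomial (ι × ι × ι) ℂ →ₐ[ℂ] MvPolynomial (Fin 3 × ι × ι) ℂ ⧸ J :=
    aeval fun c : ι × ι × ι => actTensor (ΞB 0) (ΞB 1) (ΞB 2) vB c.1 c.2.1 c.2.2 with hθB
  -- `φ ∘ θB` is the evaluation at the `L`-valued generic translate
  have hmapΞ : ∀ p, (ΞB p).map φ =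
      Matrix.of fun i j => φ (Ideal.Quotient.mk J (X (p, i, j))) := fun p => by
    ext i j; rfl
  have hmapv : (fun a b c => φ (vB a b c)) = fun a b c => algebraMap ℂ L (v a b c) := by
    funext a b c; exact φ.commutes _
  have hφθ : ∀ q, φ (θB q) = aeval (fun c : ι × ι × ι => actTensor
      (Matrix.of fun i j => φ (Ideal.Quotient.mk J (X ((0 : Fin 3), i, j))))
      (Matrix.of fun i j => φ (Ideal.Quotient.mk J (X ((1 : Fin 3), i, j))))
      (Matrix.of fun i j => φ (Ideal.Quotient.mk J (X ((2 : Fin 3), i, j))))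
      (fun a b c => algebraMap ℂ L (v a b c)) c.1 c.2.1 c.2.2) q := by
    intro q
    rw [← AlgHom.comp_apply]
    congr 1
    refine MvPolynomial.algHom_ext fun c => ?_
    rw [AlgHom.comp_apply, hθB, aeval_X, aeval_X, map_actTensor, hmapΞ, hmapΞ, hmapΞ, hmapv]
  have hθf : θB f = 0 := hφ (by rw [hφθ, hf, map_zero])
  -- evaluation at `g ∈ SL³(ℂ)` factors through `B`
  have horbit : ∀ g : Matrix.SpecialLinearGroup ι ℂ × Matrix.SpecialLinearGroup ι ℂ ×
      Matrix.SpecialLinearGroup ι ℂ,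
      aeval (fun c : ι × ι × ι => actTensor (g.1 : Matrix ι ι ℂ) (g.2.1 : Matrix ι ι ℂ)
        (g.2.2 : Matrix ι ι ℂ) v c.1 c.2.1 c.2.2) f = 0 := by
    intro g
    set gm : Fin 3 → Matrix ι ι ℂ := ![(g.1 : Matrix ι ι ℂ), (g.2.1 : Matrix ι ι ℂ),
      (g.2.2 : Matrix ι ι ℂ)] with hgm
    have hgdet : ∀ p, (gm p).det = 1 := by
      intro p
      fin_cases p <;> simp [hgm, Matrix.SpecialLinearGroup.det_coe]
    have hJg := aeval_mem_span_det_sub_one_eq_zero gm hgdet J hJ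
    set evg : (MvPolynomial (Fin 3 × ι × ι) ℂ ⧸ J) →ₐ[ℂ] ℂ := Ideal.Quotient.liftₐ J
      (aeval fun s : Fin 3 × ι × ι => gm s.1 s.2.1 s.2.2) hJg with hevg
    have hev : ∀ p, (ΞB p).map evg = gm p := by
      intro p
      ext i j
      rw [Matrix.map_apply, hΞB]
      simp only [Matrix.of_apply]
      rw [hevg, Ideal.Quotient.liftₐ_apply, Ideal.Quotient.lift_mk, AlgHom.coe_toRingHom, aeval_X]
    have hev' : (fun a b c => evg (vB a b c)) = v := by
      funext a b c; exact evg.commutes _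
    have hcomp : ∀ q, evg (θB q) = aeval (fun c : ι × ι × ι => actTensor (g.1 : Matrix ι ι ℂ)
        (g.2.1 : Matrix ι ι ℂ) (g.2.2 : Matrix ι ι ℂ) v c.1 c.2.1 c.2.2) q := by
      intro q
      rw [← AlgHom.comp_apply]
      congr 1
      refine MvPolynomial.algHom_ext fun c => ?_
      rw [AlgHom.comp_apply, hθB, aeval_X, aeval_X, map_actTensor, hev, hev, hev, hev']
      rfl
    rw [← hcomp, hθf, map_zero]
  -- the zero set of `f` is closed and contains the orbit, hence `w`
  have hcont : Continuous fun t : ι → ι → ι → ℂ =>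
      aeval (fun c : ι × ι × ι => t c.1 c.2.1 c.2.2) f := by
    have h1 : Continuous fun t : ι → ι → ι → ℂ => fun c : ι × ι × ι => t c.1 c.2.1 c.2.2 :=
      continuous_pi fun c => ((continuous_apply c.2.2).comp
        ((continuous_apply c.2.1).comp (continuous_apply c.1)))
    have h2 : Continuous fun x : ι × ι × ι → ℂ => aeval x f := by
      have : (fun x : ι × ι × ι → ℂ => aeval x f) = fun x => eval x f := by
        funext x; rfl
      rw [this]
      exact MvPolynomial.continuous_eval f
    exact h2.comp h1
  have hclosed : IsClosed {t : ι → ι → ι → ℂ |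
      aeval (fun c : ι × ι × ι => t c.1 c.2.1 c.2.2) f = 0} :=
    isClosed_eq hcont continuous_const
  have hsub : (Set.range fun g : Matrix.SpecialLinearGroup ι ℂ ×
        Matrix.SpecialLinearGroup ι ℂ × Matrix.SpecialLinearGroup ι ℂ =>
      (fun a b c => ∑ a', ∑ b', ∑ c', (g.1 : Matrix ι ι ℂ) a a' * (g.2.1 : Matrix ι ι ℂ) b b' *
        (g.2.2 : Matrix ι ι ℂ) c c' * v a' b' c')) ⊆
      {t : ι → ι → ι → ℂ | aeval (fun c : ι × ι × ι => t c.1 c.2.1 c.2.2) f = 0} := by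
    rintro _ ⟨g, rfl⟩
    exact horbit g
  exact (hclosed.closure_subset_iff.mpr hsub) hcl

/-- **A valuation ring for the generic translate.** If `w ∈ cl(SL_ι(ℂ)³·v)` then, for any injective
`ℂ`-algebra map `φ` of the coordinate ring of `SL_ι³` into a field `L`, there is a valuation
subring `O ⊆ L` containing `ℂ` and the entries of the generic translate `t_L = Ξ·v`, such that
`t_L ≡ w` modulo the maximal ideal of `O` (`v(t_L - w) < 1` entrywise). Construction: the local
ring of `ℂ[y]/ker(y ↦ t_L)` at the point `w` (which lies on this variety by
`aeval_eq_zero_of_mem_closure_orbit`) maps injectively to `L` and is dominated by a valuation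
ring (Stacks 00IA, Mathlib `IsLocalRing.exists_factor_valuationRing`). [folklore] -/
theorem exists_valuationSubring_generic_translate (v w : ι → ι → ι → ℂ)
    (hcl : w ∈ closure (Set.range fun g : Matrix.SpecialLinearGroup ι ℂ ×
        Matrix.SpecialLinearGroup ι ℂ × Matrix.SpecialLinearGroup ι ℂ =>
      (fun a b c => ∑ a', ∑ b', ∑ c', (g.1 : Matrix ι ι ℂ) a a' * (g.2.1 : Matrix ι ι ℂ) b b' *
        (g.2.2 : Matrix ι ι ℂ) c c' * v a' b' c')))
    (J : Ideal (MvPolynomial (Fin 3 × ι × ι) ℂ))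
    (hJ : J = Ideal.span (Set.range fun p : Fin 3 =>
      (Matrix.of fun i j => (X (p, i, j) : MvPolynomial (Fin 3 × ι × ι) ℂ)).det - 1))
    {L : Type*} [Field L] [Algebra ℂ L] (φ : (MvPolynomial (Fin 3 × ι × ι) ℂ ⧸ J) →ₐ[ℂ] L)
    (hφ : Function.Injective φ) :
    ∃ O : ValuationSubring L, (∀ z : ℂ, algebraMap ℂ L z ∈ O) ∧
      (∀ a b c, actTensor
        (Matrix.of fun i j => φ (Ideal.Quotient.mk J (X ((0 : Fin 3), i, j))))
        (Matrix.of fun i j => φ (Ideal.Quotient.mk J (X ((1 : Fin 3), i, j))))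
        (Matrix.of fun i j => φ (Ideal.Quotient.mk J (X ((2 : Fin 3), i, j))))
        (fun a b c => algebraMap ℂ L (v a b c)) a b c ∈ O) ∧
      (∀ a b c, O.valuation (actTensor
        (Matrix.of fun i j => φ (Ideal.Quotient.mk J (X ((0 : Fin 3), i, j))))
        (Matrix.of fun i j => φ (Ideal.Quotient.mk J (X ((1 : Fin 3), i, j))))
        (Matrix.of fun i j => φ (Ideal.Quotient.mk J (X ((2 : Fin 3), i, j))))
        (fun a b c => algebraMap ℂ L (v a b c)) a b c - algebraMap ℂ L (w a b c)) < 1) := by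
  classical
  set tL : ι → ι → ι → L := actTensor
        (Matrix.of fun i j => φ (Ideal.Quotient.mk J (X ((0 : Fin 3), i, j))))
        (Matrix.of fun i j => φ (Ideal.Quotient.mk J (X ((1 : Fin 3), i, j))))
        (Matrix.of fun i j => φ (Ideal.Quotient.mk J (X ((2 : Fin 3), i, j))))
        (fun a b c => algebraMap ℂ L (v a b c)) with htL
  -- `θ : ℂ[y] → L`, its (prime) kernel `𝔭`, and the point `w ∈ V(𝔭)`
  set θ : MvPolynomial (ι × ι × ι) ℂ →ₐ[ℂ] L := aeval fun c : ι × ι × ι => tL c.1 c.2.1 c.2.2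
    with hθ
  set 𝔭 : Ideal (MvPolynomial (ι × ι × ι) ℂ) := RingHom.ker θ with h𝔭
  have hw𝔭 : ∀ q ∈ 𝔭, aeval (fun c : ι × ι × ι => w c.1 c.2.1 c.2.2) q = 0 := fun q hq =>
    aeval_eq_zero_of_mem_closure_orbit v w hcl J hJ φ hφ q (by rw [RingHom.mem_ker] at hq; exact hq)
  -- `A' = ℂ[y]/𝔭 ↪ L`, the evaluation `A' → ℂ` at `w`, its kernel `m̄`
  set θbar : (MvPolynomial (ι × ι × ι) ℂ ⧸ 𝔭) →ₐ[ℂ] L :=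
    Ideal.Quotient.liftₐ 𝔭 θ (fun a ha => ha) with hθbar
  have hθbar_mk : ∀ q, θbar (Ideal.Quotient.mk 𝔭 q) = θ q := fun q => by
    rw [hθbar, Ideal.Quotient.liftₐ_apply, Ideal.Quotient.lift_mk, AlgHom.coe_toRingHom]
  have hθbar_inj : Function.Injective θbar := by
    intro x y hxy
    induction x using Quotient.inductionOn with
    | h x =>
      induction y using Quotient.inductionOn with
      | h y =>
        change θbar (Ideal.Quotient.mk 𝔭 x) = θbar (Ideal.Quotient.mk 𝔭 y) at hxy
        rw [hθbar_mk, hθbar_mk] at hxy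
        change Ideal.Quotient.mk 𝔭 x = Ideal.Quotient.mk 𝔭 y
        rw [Ideal.Quotient.eq, h𝔭, RingHom.mem_ker, map_sub, hxy, sub_self]
  set evw : (MvPolynomial (ι × ι × ι) ℂ ⧸ 𝔭) →ₐ[ℂ] ℂ := Ideal.Quotient.liftₐ 𝔭
    (aeval fun c : ι × ι × ι => w c.1 c.2.1 c.2.2) hw𝔭 with hevw
  set mbar : Ideal (MvPolynomial (ι × ι × ι) ℂ ⧸ 𝔭) := RingHom.ker evw with hmbar
  haveI hmax : mbar.IsMaximal := RingHom.ker_isMaximal_of_surjective evw fun z =>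
    ⟨algebraMap ℂ _ z, evw.commutes z⟩
  -- the local ring at `w` maps to `L`
  have hunits : ∀ y : mbar.primeCompl, IsUnit (θbar.toRingHom y) := by
    intro y
    rw [isUnit_iff_ne_zero]
    intro h0
    have hy0 : (y : MvPolynomial (ι × ι × ι) ℂ ⧸ 𝔭) = 0 := hθbar_inj (by
      rw [map_zero]; exact h0)
    exact y.2 (by rw [hy0]; exact mbar.zero_mem)
  set j : Localization.AtPrime mbar →+* L := IsLocalization.lift (M := mbar.primeCompl) hunits
    with hj
  have hjalg : ∀ a : MvPolynomial (ι × ι × ι) ℂ ⧸ 𝔭,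
      j (algebraMap _ (Localization.AtPrime mbar) a) = θbar a := fun a =>
    IsLocalization.lift_eq (M := mbar.primeCompl) hunits a
  -- a valuation ring of `L` dominating it
  obtain ⟨O, hO, hloc⟩ :=
    IsLocalRing.exists_factor_valuationRing (R := Localization.AtPrime mbar) (K := L) j
  refine ⟨O, fun z => ?_, fun a b c => ?_, fun a b c => ?_⟩
  · -- constants
    have : algebraMap ℂ L z = j (algebraMap _ (Localization.AtPrime mbar)
        (algebraMap ℂ (MvPolynomial (ι × ι × ι) ℂ ⧸ 𝔭) z)) := by
      rw [hjalg, AlgHom.commutes]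
    rw [this]
    exact hO _
  · -- entries of the generic translate
    have : tL a b c = j (algebraMap _ (Localization.AtPrime mbar)
        (Ideal.Quotient.mk 𝔭 (X (a, b, c)))) := by
      rw [hjalg, hθbar_mk, hθ, aeval_X]
    rw [this]
    exact hO _
  · -- residues: `x_c - w_c ∈ m̄` maps to a non-unit of `O`
    set y : MvPolynomial (ι × ι × ι) ℂ ⧸ 𝔭 :=
      Ideal.Quotient.mk 𝔭 (X (a, b, c)) - algebraMap ℂ _ (w a b c) with hy
    have hym : y ∈ mbar := by
      rw [hmbar, RingHom.mem_ker, hy, map_sub, AlgHom.commutes, hevw, Ideal.Quotient.liftₐ_apply,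
        Ideal.Quotient.lift_mk, AlgHom.coe_toRingHom, aeval_X]
      exact sub_self _
    have hyR : algebraMap _ (Localization.AtPrime mbar) y ∈
        IsLocalRing.maximalIdeal (Localization.AtPrime mbar) :=
      (IsLocalization.AtPrime.to_map_mem_maximal_iff (Localization.AtPrime mbar) mbar y).mpr hym
    have hval : tL a b c - algebraMap ℂ L (w a b c) =
        j (algebraMap _ (Localization.AtPrime mbar) y) := by
      rw [hjalg, hy, map_sub, hθbar_mk, hθ, aeval_X, AlgHom.commutes]
    rw [hval]
    -- non-unit in the local ring ⇒ non-unit in `O` (local homomorphism) ⇒ valuation `< 1`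
    have hnu : ¬ IsUnit ((j.codRestrict O.toSubring hO)
        (algebraMap _ (Localization.AtPrime mbar) y)) := by
      intro hu
      haveI := hloc
      exact (IsLocalRing.mem_maximalIdeal _).mp hyR (IsLocalHom.map_nonunit _ hu)
    have hnu' : ¬ IsUnit (⟨j (algebraMap _ (Localization.AtPrime mbar) y), hO _⟩ : O) := hnu
    exact (ValuationSubring.valuation_lt_one_iff O ⟨j (algebraMap _ (Localization.AtPrime mbar) y),
      hO _⟩).mp ((IsLocalRing.mem_maximalIdeal _).mpr hnu')

end Generic

end Literature.RepresentationTheory.AlgebraicGroups
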